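import Summits.BirchSwinnertonDyer.Rank1Residual.X11a.SelmerCompanionAtP
import Summits.BirchSwinnertonDyer.Rank1Residual.X11a.SelmerCompanionKinds
import HarnessLib

/-!
# Route (3e) SELMER COMPANION, IX: the count over `ℚ` with FIVE kinds of places, and shape C
# (the place of `p` of kind (v): `E` non-split multiplicative, `A` good) (class X11a = N7; cell
# `b2b-bsdres`, unit `b2b-bsdres-x11a`, gen 27)

HONEST FRAMING (run/shared/lean/b2b/bsd-rank1-residual/, verbatim in every file): the goal of the
cell is to DELETE the COMBINATION-SHAPED residual classes of the Birch–Swinnerton-Dyer formula for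
ALL analytic-rank `≤ 1` elliptic curves over `ℚ` — "full BSD formula for every rank `≤ 1` curve in
class `C`" assembled STRICTLY from published theorems — so that the rank-`≤ 1` remainder becomes
exactly the CONSTRUCTION-SHAPED classes, which are TYPED (missing-input `Prop`s), NOT attempted.
This is not "finishing BSD". CLASS-OWNERS.md: research routes; NO CLAIM BEYOND STATED CLASSES.
THEOREMS ONLY; nothing booked; no label moves. CONDITIONAL on the PUBLISHED binders GZK (`hGZK`),
Cassels–Tate (`hCT`), Tate uniformisation (`hU` = A40, `hU2` = A41) and Tate's local Euler
characteristic (`hEP`, Milne *ADT* I Thm. 2.8), and on the per-pair finite data named.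

`natCard_selmerGroup_le_of_congr_of_five_kinds_rat`: file V's count over `ℚ` with a FIFTH kind of
place where the local conditions agree along `θ : E[p] ≃ A[p]`: (v) the place of `p` itself, `E`
NON-SPLIT multiplicative at `p` (`γ(E)` not a square in `ℚ_p`) and `A` GOOD at `p` — lemma L-p-ns of
file VIII-b. `bsdp_of_bsdp_partner_of_selmerCompanion_nonsplit_at_p`: SHAPE C of the route —
`BSD(A,p) ⟹ BSD(E,p)` at a rank-`0` pair with `E` non-split multiplicative at `p` and a closed
partner `A` good at `p`, the lossy places `T` prime to `p`, budget `p^{r_an(A)} · ∏_{v∈T} #E(ℚ_v)[p] ≤ p`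
— so a rank-ONE good partner, or a rank-`0` good partner plus one place with `#E(ℚ_v)[p] = p`, now
suffices for a non-split cell (gen-26 census §5: `p = 3` reach ≈ 48 → 60 residue cells of N7; the
`p = 5` leaf gains the rank-`1`-partner cells; re-run by the census of this gen).

References: files I–VIII; [MazurRubin2004] §2.3; [GreenbergLNM1716] §2; [MilneADT2006] I Thm. 2.8;
[Miller2011LMS] Def. 1.1; HOME/b2b-bsdres-x11a/REPORT-g27.md.
-/

set_option autoImplicit false

noncomputable section

open scoped Classical NNReal

open WeierstrassCurve Literature.NumberTheory.EllipticCurves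
  Literature.NumberTheory.GaloisRepresentations Field NumberField IsDedekindDomain
  Literature.NumberTheory.EllipticCurves.Rank1Residual
  Literature.NumberTheory.EllipticCurves.Rank1Residual.Typed

namespace Summit.BirchSwinnertonDyer.Rank1Residual.X11a.SelmerCompanion

section Rat

variable (W A : WeierstrassCurve ℚ) [W.IsElliptic] [W.IsGloballyMinimal] [A.IsElliptic]
  [A.IsGloballyMinimal] (p : ℕ) [hp : Fact p.Prime]

/-- **The count over `ℚ` with FIVE kinds of places**: for `θ : E[p] ≃ A[p]` (`E = W`, `A` globally
minimal), `p` odd, `T ⊆ S` as in file I, and every `v ∈ S \ T` of kind (i) `v ∤ p ∧ E(ℚ_v)[p] = 0`,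
(ii) both split multiplicative with `#A(ℚ_v)[p] ≤ p`, (iii) both multiplicative of the same twist
type with `μ_p(ℚ_v) = 1`, (iv) `v` the place of an odd prime `ℓ ≠ p` with `E` non-split
multiplicative and `A` good at `ℓ`, or (v) `v` the place of `p`, `E` NON-SPLIT multiplicative and `A`
GOOD at `p` (lemma L-p-ns, file VIII-b; needs `hEP`):
`#Sel^(p)(E/ℚ) ≤ #Sel^(p)(A/ℚ) · ∏_{v ∈ T} #E(ℚ_v)[p] · #(ℤ_v/p)`.
[cite: MazurRubin2004, §2.3] [cite: SilvermanATAEC1994, Ch. V Thm. 3.1, Lemma 5.2, Thm. 5.3, Cor. 5.4]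
[cite: GreenbergLNM1716, §2 Props. 2.2, 2.4] [cite: MilneADT2006, Ch. I §2, Thm. 2.8] -/
theorem natCard_selmerGroup_le_of_congr_of_five_kinds_rat
    (hU : Silverman1994_thmV53_tateUniformisation.{0})
    (hU2 : Silverman1994_thmV53_corV54_tateUniformisation.{0})
    (hEP : ∀ v : HeightOneSpectrum (𝓞 ℚ), (p : 𝓞 ℚ) ∈ v.asIdeal →
      localEulerPoincareCharacteristic (v.adicCompletion ℚ)) (hp2 : p ≠ 2)
    (θ : geomTorsion W (p : ℤ) ≃+ geomTorsion A (p : ℤ))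
    (hθ : ∀ (σ : absoluteGaloisGroup ℚ) (P : geomTorsion W (p : ℤ)), θ (σ • P) = σ • θ P)
    (S T : Finset (HeightOneSpectrum (𝓞 ℚ))) (hTS : T ⊆ S)
    (hS : ∀ v : HeightOneSpectrum (𝓞 ℚ), v ∉ S →
      A.HasGoodReductionAt v ∧ W.HasGoodReductionAt v ∧ (p : 𝓞 ℚ) ∉ v.asIdeal)
    (hplaces : ∀ v ∈ S, v ∉ T →
      ((p : 𝓞 ℚ) ∉ v.asIdeal ∧ Nat.card (nsmulAddMonoidHom p :
          (W.baseChange (v.adicCompletion ℚ)).toAffine.Point →+ _).ker = 1) ∨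
      (A.HasSplitMultiplicativeReductionAt v ∧ W.HasSplitMultiplicativeReductionAt v ∧
        Nat.card (nsmulAddMonoidHom p :
          (A.baseChange (v.adicCompletion ℚ)).toAffine.Point →+ _).ker ≤ p) ∨
      (A.HasMultiplicativeReductionAt v ∧ W.HasMultiplicativeReductionAt v ∧
        (∃ r : v.adicCompletion ℚ, algebraMap ℚ (v.adicCompletion ℚ) (-(A.c₄ / A.c₆)) =
          r ^ 2 * algebraMap ℚ (v.adicCompletion ℚ) (-(W.c₄ / W.c₆))) ∧
        (∀ ζ : v.adicCompletion ℚ, ζ ^ p = 1 → ζ = 1)) ∨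
      (∃ (ℓ : ℕ) (_ : Fact ℓ.Prime), ℓ ≠ 2 ∧ (ℓ : 𝓞 ℚ) ∈ v.asIdeal ∧ (p : 𝓞 ℚ) ∉ v.asIdeal ∧
        W.HasMultiplicativeReductionAtPrime ℓ ∧
        (∀ r : v.adicCompletion ℚ, algebraMap ℚ (v.adicCompletion ℚ) (-(W.c₄ / W.c₆)) ≠ r ^ 2) ∧
        A.HasGoodReductionAt v) ∨
      ((p : 𝓞 ℚ) ∈ v.asIdeal ∧ W.HasMultiplicativeReductionAtPrime p ∧
        (∀ r : v.adicCompletion ℚ, algebraMap ℚ (v.adicCompletion ℚ) (-(W.c₄ / W.c₆)) ≠ r ^ 2) ∧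
        A.HasGoodReductionAtPrime p)) :
    Nat.card (W.selmerGroup (p : ℤ)) ≤
      Nat.card (A.selmerGroup (p : ℤ)) *
        ∏ v ∈ T, (Nat.card (nsmulAddMonoidHom p :
            (W.baseChange (v.adicCompletion ℚ)).toAffine.Point →+ _).ker *
          Nat.card (v.adicCompletionIntegers ℚ ⧸
            Ideal.span {(p : v.adicCompletionIntegers ℚ)})) := by
  have hpp : p.Prime := hp.out
  classical
  -- enlarge `T` by the places of kind (i)
  set T' := T ∪ S.filter (fun v ↦ (p : 𝓞 ℚ) ∉ v.asIdeal ∧ Nat.card (nsmulAddMonoidHom p :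
      (W.baseChange (v.adicCompletion ℚ)).toAffine.Point →+ _).ker = 1) with hT'
  have hT'S : T' ⊆ S := Finset.union_subset hTS (Finset.filter_subset _ _)
  have h1 := natCard_selmerGroup_le_of_congr_of_le_off A W hp2 θ hθ S T' hT'S hS
    (fun v hv hvT c hc ↦ ?_)
  · refine h1.trans (Nat.mul_le_mul_left _ (le_of_eq ?_))
    have hsplit : T' = T ∪ (S.filter (fun v ↦ (p : 𝓞 ℚ) ∉ v.asIdeal ∧ Nat.card (nsmulAddMonoidHom p :
      (W.baseChange (v.adicCompletion ℚ)).toAffine.Point →+ _).ker = 1) \ T) := by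
      rw [hT', Finset.union_sdiff_self_eq_union]
    rw [hsplit, Finset.prod_union Finset.disjoint_sdiff,
      Finset.prod_eq_one (s := _ \ T) (fun v hv ↦ ?_), mul_one]
    · refine Finset.prod_congr rfl fun v _ ↦ ?_
      exact W.natCard_kummerLocalConditionAt_adicCompletion v hpp.ne_zero
    · rw [Finset.mem_sdiff, Finset.mem_filter] at hv
      rw [W.natCard_kummerLocalConditionAt_adicCompletion v hpp.ne_zero, hv.1.2.2, one_mul,
        natCard_quot_adicCompletionIntegers_eq_one hv.1.2.1]
  · have hvT0 : v ∉ T := fun h ↦ hvT (Finset.mem_union_left _ h)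
    have hnot1 : ¬ ((p : 𝓞 ℚ) ∉ v.asIdeal ∧ Nat.card (nsmulAddMonoidHom p :
        (W.baseChange (v.adicCompletion ℚ)).toAffine.Point →+ _).ker = 1) := fun h ↦
      hvT (Finset.mem_union_right _ (Finset.mem_filter.mpr ⟨hv, h⟩))
    rcases hplaces v hv hvT0 with h1 | ⟨hWv, hW'v, hcard⟩ | ⟨hWv, hW'v, hγ', hμ⟩ |
        ⟨ℓ, hℓ, hℓ2, hℓv, hpv, hmult, hγ', hAv⟩ | ⟨hpv, hmult, hγ', hAv⟩
    · exact absurd h1 hnot1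
    · exact A.h1Equiv_mem_selmerLocalKer_of_hasSplitMultiplicativeReductionAt v hU W θ hθ hWv hW'v
        hcard hc
    · exact A.h1Equiv_mem_selmerLocalKer_of_hasMultiplicativeReductionAt v hU2 hp2 W θ hθ hWv hW'v
        hγ' hμ hc
    · haveI := hℓ
      exact h1Equiv_mem_selmerLocalKer_of_nonsplit_of_good_rat W A p hU2 hp2 θ hθ hℓ2 hℓv hmult hγ'
        hAv hpv hc
    · exact h1Equiv_mem_selmerLocalKer_of_nonsplit_of_good_at_p W A p hU2 hp2 θ hθ hpv (hEP v hpv)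
        hmult hγ' hAv hc

/-- **Shape C (route (3e) over `ℚ`): `BSD(A,p) ⟹ BSD(E,p)` at a rank-`0` pair `(E, p)` with `E`
NON-SPLIT multiplicative and the closed partner `A` GOOD at the odd prime `p`** (`E[p]` irreducible,
`p ∤ #Ш_an(E)`, `p ∤ #Ш_an(A)`, `r_an(A) ≤ 1`): the place of `p` costs nothing (kind (v)); the lossy
set `T ⊆ S` is prime to `p`; the other places of `S` are of kinds (i)–(iv); and the budget is
`p^{r_an(A)} · ∏_{v ∈ T} #E(ℚ_v)[p] ≤ p` — a rank-ONE good partner with `T = ∅`, or a rank-`0` one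
with one place of cost `p`. Binders GZK, Cassels–Tate, A40/A41, Tate's Euler characteristic. Not a
class theorem; nothing booked. [cite: MazurRubin2004, §2.3] [cite: Miller2011LMS, §1 and Def. 1.1]
[cite: GreenbergLNM1716, §2 Props. 2.2, 2.4] [cite: MilneADT2006, Ch. I §2, Thm. 2.8] -/
theorem bsdp_of_bsdp_partner_of_selmerCompanion_nonsplit_at_p
    (hU : Silverman1994_thmV53_tateUniformisation.{0})
    (hU2 : Silverman1994_thmV53_corV54_tateUniformisation.{0})
    (hEP : ∀ v : HeightOneSpectrum (𝓞 ℚ), (p : 𝓞 ℚ) ∈ v.asIdeal →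
      localEulerPoincareCharacteristic (v.adicCompletion ℚ))
    (hGZK : rank_eq_analyticRank_of_analyticRank_le_one)
    (hCT : exists_casselsTate_pairing (K := ℚ)) (hp2 : p ≠ 2)
    (hr : W.analyticRank = 0) (hirr : Irr W p) (hSha : X11a.ShaAnUnit W p)
    (hmult : W.HasMultiplicativeReductionAtPrime p)
    (hns : ∀ v : HeightOneSpectrum (𝓞 ℚ), (p : 𝓞 ℚ) ∈ v.asIdeal →
      ∀ r : v.adicCompletion ℚ, algebraMap ℚ (v.adicCompletion ℚ) (-(W.c₄ / W.c₆)) ≠ r ^ 2)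
    (hgoodA : A.HasGoodReductionAtPrime p)
    (hbsdA : BSDp A p) (hShaA : X11a.ShaAnUnit A p)
    (e : geomTorsion A (p : ℤ) ≃+ geomTorsion W (p : ℤ))
    (he : ∀ (σ : absoluteGaloisGroup ℚ) (P : geomTorsion A (p : ℤ)), e (σ • P) = σ • e P)
    (S T : Finset (HeightOneSpectrum (𝓞 ℚ))) (hTS : T ⊆ S)
    (hTp : ∀ v ∈ T, (p : 𝓞 ℚ) ∉ v.asIdeal)
    (hS : ∀ v : HeightOneSpectrum (𝓞 ℚ), v ∉ S →
      A.HasGoodReductionAt v ∧ W.HasGoodReductionAt v ∧ (p : 𝓞 ℚ) ∉ v.asIdeal)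
    (haway : ∀ v ∈ S, v ∉ T → (p : 𝓞 ℚ) ∉ v.asIdeal →
      Nat.card (nsmulAddMonoidHom p :
          (W.baseChange (v.adicCompletion ℚ)).toAffine.Point →+ _).ker = 1 ∨
      (A.HasSplitMultiplicativeReductionAt v ∧ W.HasSplitMultiplicativeReductionAt v ∧
        Nat.card (nsmulAddMonoidHom p :
          (A.baseChange (v.adicCompletion ℚ)).toAffine.Point →+ _).ker ≤ p) ∨
      (A.HasMultiplicativeReductionAt v ∧ W.HasMultiplicativeReductionAt v ∧
        (∃ r : v.adicCompletion ℚ, algebraMap ℚ (v.adicCompletion ℚ) (-(A.c₄ / A.c₆)) =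
          r ^ 2 * algebraMap ℚ (v.adicCompletion ℚ) (-(W.c₄ / W.c₆))) ∧
        (∀ ζ : v.adicCompletion ℚ, ζ ^ p = 1 → ζ = 1)) ∨
      (∃ (ℓ : ℕ) (_ : Fact ℓ.Prime), ℓ ≠ 2 ∧ (ℓ : 𝓞 ℚ) ∈ v.asIdeal ∧
        W.HasMultiplicativeReductionAtPrime ℓ ∧
        (∀ r : v.adicCompletion ℚ, algebraMap ℚ (v.adicCompletion ℚ) (-(W.c₄ / W.c₆)) ≠ r ^ 2) ∧
        A.HasGoodReductionAt v))
    (hbudget : p ^ A.analyticRank * ∏ v ∈ T, Nat.card (nsmulAddMonoidHom p :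
        (W.baseChange (v.adicCompletion ℚ)).toAffine.Point →+ _).ker ≤ p) :
    BSDp W p := by
  have hpp : p.Prime := hp.out
  classical
  -- irreducibility of `A[p]`, the partner's count, and the transport along `θ = e⁻¹`
  have hθ : ∀ (σ : absoluteGaloisGroup ℚ) (Q : geomTorsion W (p : ℤ)),
      e.symm (σ • Q) = σ • e.symm Q := fun σ Q ↦ by
    apply e.injective
    rw [e.apply_symm_apply, he, e.apply_symm_apply]
  have hirrA : Irr A p := GreenbergVatsal2000.hasIrreducibleModPGaloisRep_of_torsionIso e.symm hθ hirr
  have hSelA := natCard_selmerGroup_eq_pow_of_bsdp A p hbsdA hShaA hirrA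
  have hle := natCard_selmerGroup_le_of_congr_of_five_kinds_rat W A p hU hU2 hEP hp2 e.symm hθ S T
    hTS hS (fun v hv hvT ↦ ?_)
  · refine bsdp_of_natCard_selmerGroup_le W p hGZK hCT hr hirr hSha (hle.trans ?_)
    have hprod : ∏ v ∈ T, (Nat.card (nsmulAddMonoidHom p :
          (W.baseChange (v.adicCompletion ℚ)).toAffine.Point →+ _).ker *
        Nat.card (v.adicCompletionIntegers ℚ ⧸ Ideal.span {(p : v.adicCompletionIntegers ℚ)})) =
        ∏ v ∈ T, Nat.card (nsmulAddMonoidHom p :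
          (W.baseChange (v.adicCompletion ℚ)).toAffine.Point →+ _).ker := by
      refine Finset.prod_congr rfl fun v hv ↦ ?_
      rw [natCard_quot_adicCompletionIntegers_eq_one (hTp v hv), mul_one]
    rw [hSelA, hprod]
    exact hbudget
  · by_cases hvp : (p : 𝓞 ℚ) ∈ v.asIdeal
    · exact Or.inr (Or.inr (Or.inr (Or.inr ⟨hvp, hmult, hns v hvp, hgoodA⟩)))
    · rcases haway v hv hvT hvp with h1 | h2 | h3 | ⟨ℓ, hℓ, hℓ2, hℓv, hmultℓ, hγ', hAv⟩
      · exact Or.inl ⟨hvp, h1⟩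
      · exact Or.inr (Or.inl h2)
      · exact Or.inr (Or.inr (Or.inl h3))
      · exact Or.inr (Or.inr (Or.inr (Or.inl ⟨ℓ, hℓ, hℓ2, hℓv, hvp, hmultℓ, hγ', hAv⟩)))

end Rat

end Summit.BirchSwinnertonDyer.Rank1Residual.X11a.SelmerCompanion

end
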